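import Summits.CriticalPhenomena.PercolationContinuityZ3.Theorems.SahiMasterFamilyOrShapeSettled

/-!
# The OR-shape at every order, VII: members CONTAINING the coordinate event (consumer form)

Unit `prim-master-conj` (crux anchor stmt-CriticalPhenomena-4575, helper work), gen 17; memo
`run/shared/lean/prim/prim-l12/prim-master-conj/POINTWISE.md` §18.  Parts III/VI state class (B)_k for members written as `B_j ∪ {e∈ω}` with `B_j`
`e`-free.  Every INCREASING event `V ⊇ {e∈ω}` is of this form with `B = V^{e←0}` (`eq_secAt_false_union_coord`), so here are the same theorems for a family
`U = (A, V_0, …, V_n)` with `A, V_j` increasing and `{e∈ω} ⊆ V_j` — the hypotheses on the merged families refer to the `0`-sections `V_j^{e←0}`: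
`sahiE_orShape_dominates_of_supset` (domination `(1−p_e)^{n+1}·E(U^{e←0}) ≤ E(U)` and `E(U) ≥ 0`) and `sahiE_orShape_settled_of_supset` (settledness).
HONEST FRAMING: repackaging; `C_k` / `MasterFamilyEqIff k` remain open in general.  Axioms standard. [this work]
-/

set_option autoImplicit false

open Finset

noncomputable section

open scoped Classical

namespace Summit.CriticalPhenomena.PercolationContinuityZ3.Theorems

namespace OrShape

open Function
open Literature.Combinatorics.Sahi2008
open Literature.Combinatorics.Sahi2008.SqFree
open Literature.Probability.Percolation.DecisionTree (ind ind_of_mem ind_of_not_mem ind_nonneg)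

section Supset

variable {ι : Type} [Fintype ι] (e : ι) {n : ℕ}

omit [Fintype ι] in
/-- An increasing event containing the coordinate event `{e∈ω}` is its `0`-section OR `{e∈ω}`. [folklore] -/
theorem eq_secAt_false_union_coord {V : Set (Set ι)} (hV : IsUpperSet V) (he : {ω : Set ι | e ∈ ω} ⊆ V) :
    V = secAt e false V ∪ {ω : Set ι | e ∈ ω} := by
  ext ω
  simp only [Set.mem_union, Set.mem_setOf_eq, mem_secAt, forceAt, cond_false]
  constructor
  · intro hω
    by_cases heω : e ∈ ω
    · exact Or.inr heω
    · left; rwa [Set.sdiff_singleton_eq_self heω]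
  · rintro (h | h)
    · exact hV Set.sdiff_subset h
    · exact he h

omit [Fintype ι] in
/-- `0`-sections are `e`-free. [folklore] -/
theorem secAt_secAt_false (b : Bool) (V : Set (Set ι)) : secAt e b (secAt e false V) = secAt e false V :=
  secAt_secAt_eq e b false V

omit [Fintype ι] in
/-- The OR-shape normal form of a family whose tail members contain `{e∈ω}`. [this work] -/
theorem vecCons_eq_orShape (A : Set (Set ι)) {V : Fin (n + 1) → Set (Set ι)} (hV : ∀ j, IsUpperSet (V j))
    (hVe : ∀ j, {ω : Set ι | e ∈ ω} ⊆ V j) :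
    (Matrix.vecCons A V : Fin (n + 2) → Set (Set ι)) =
      Matrix.vecCons A (fun j => secAt e false (V j) ∪ {ω : Set ι | e ∈ ω}) := by
  funext j; refine Fin.cases ?_ (fun j' => ?_) j
  · rfl
  · simp only [Matrix.cons_val_succ]; exact eq_secAt_false_union_coord e (hV j') (hVe j')

/-- **Class (B) at every order, consumer form**: `A, V_0,…,V_n` increasing with `{e∈ω} ⊆ V_j`; if every merged family
`(A^{e←0}, (⋂_{j : c j = i} V_j^{e←0})_{i<r})` (surjective labellings `c`) has `E_{r+1}(μ_p;·) ≥ 0`, then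
`(1 − p_e)^{n+1}·E_{n+2}(μ_p; 1_{A^{e←0}}, (1_{V_j^{e←0}})_j) ≤ E_{n+2}(μ_p; 1_A, (1_{V_j})_j)` and the latter is `≥ 0`. [this work] -/
theorem sahiE_orShape_dominates_of_supset (p : ι → unitInterval) {A : Set (Set ι)} (hA : IsUpperSet A) {V : Fin (n + 1) → Set (Set ι)}
    (hV : ∀ j, IsUpperSet (V j)) (hVe : ∀ j, {ω : Set ι | e ∈ ω} ⊆ V j)
    (Hmap : ∀ (r : ℕ) (c : Fin (n + 1) → Fin r), Function.Surjective c →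
      0 ≤ sahiE (bernoulliWeight p) (r + 1) (Matrix.vecCons (ind (secAt e false A))
        (fun i => ind (⋂ j ∈ (univ : Finset (Fin (n + 1))).filter (fun j => c j = i), secAt e false (V j))))) :
    (1 - (p e : ℝ)) ^ (n + 1) * sahiE (bernoulliWeight p) (n + 2) (Matrix.vecCons (ind (secAt e false A)) (fun j => ind (secAt e false (V j)))) ≤
        sahiE (bernoulliWeight p) (n + 2) (fun j => ind ((Matrix.vecCons A V : Fin (n + 2) → Set (Set ι)) j)) ∧
      0 ≤ sahiE (bernoulliWeight p) (n + 2) (fun j => ind ((Matrix.vecCons A V : Fin (n + 2) → Set (Set ι)) j)) := by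
  rw [vecCons_eq_orShape e A hV hVe, Pinning.ind_vecCons]
  exact sahiE_orShape_dominates_of_labels e A (fun j => secAt e false (V j)) p hA (fun j b => secAt_secAt_false e b (V j)) Hmap

/-- **The settled class is closed under "all members but one contain `{e∈ω}`", every order, consumer form**: `p` interior, `A, V_j` increasing,
`{e∈ω} ⊆ V_j`; if every merged family `(A^{e←0}, (⋂_{j : c j = i} V_j^{e←0})_{i<r})` is settled on the open cube then so is `U = (A, V_0,…,V_n)` at `p`.
[this work] -/
theorem sahiE_orShape_settled_of_supset {p : ι → unitInterval} (hp : ∀ i, (p i : ℝ) ∈ Set.Ioo (0 : ℝ) 1) {A : Set (Set ι)} (hA : IsUpperSet A)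
    {V : Fin (n + 1) → Set (Set ι)} (hV : ∀ j, IsUpperSet (V j)) (hVe : ∀ j, {ω : Set ι | e ∈ ω} ⊆ V j)
    (HsetL : ∀ (r : ℕ) (c : Fin (n + 1) → Fin r), Function.Surjective c →
      ∀ q : ι → unitInterval, (∀ i, (q i : ℝ) ∈ Set.Ioo (0 : ℝ) 1) →
        0 ≤ sahiE (bernoulliWeight q) (r + 1) (Matrix.vecCons (ind (secAt e false A))
          (fun i => ind (⋂ j ∈ (univ : Finset (Fin (n + 1))).filter (fun j => c j = i), secAt e false (V j)))) ∧
        (sahiE (bernoulliWeight q) (r + 1) (Matrix.vecCons (ind (secAt e false A))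
          (fun i => ind (⋂ j ∈ (univ : Finset (Fin (n + 1))).filter (fun j => c j = i), secAt e false (V j)))) = 0 ↔
          SuppZeroFlag (r + 1) (Matrix.vecCons (secAt e false A)
            (fun i => ⋂ j ∈ (univ : Finset (Fin (n + 1))).filter (fun j => c j = i), secAt e false (V j)) : Fin (r + 1) → Set (Set ι)))) :
    0 ≤ sahiE (bernoulliWeight p) (n + 2) (fun j => ind ((Matrix.vecCons A V : Fin (n + 2) → Set (Set ι)) j)) ∧
      (sahiE (bernoulliWeight p) (n + 2) (fun j => ind ((Matrix.vecCons A V : Fin (n + 2) → Set (Set ι)) j)) = 0 ↔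
        SuppZeroFlag (n + 2) (Matrix.vecCons A V : Fin (n + 2) → Set (Set ι))) := by
  rw [vecCons_eq_orShape e A hV hVe]
  exact sahiE_orShape_settled_of_labels hp e hA (fun j => isUpperSet_secAt e false (hV j)) (fun j b => secAt_secAt_false e b (V j)) HsetL

end Supset

end OrShape
end Summit.CriticalPhenomena.PercolationContinuityZ3.Theorems
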